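import Literature.Barriers.AtomisticToContinuum.HalfFillingDischarges
import Literature.MathematicalPhysics.QuantumLattice.DuhamelTwoPoint
import HarnessLib

/-!
# Hard-core lattice bosons at half filling: discharge of the energy bound (Dᵀ)

`Literature/Barriers/AtomisticToContinuum`; sibling proof file of `HalfFillingThermalKLS.lean`
(item `provefact-Literature.Barriers.AtomisticToContinuum.HalfFillingReflectionPositivity`,
fact (Dᵀ) `hc_bondCorr_lower_thermal`). No statement is introduced or changed; this file proves

* `hc_bondCorr_lower_thermal_holds : hc_bondCorr_lower_thermal` — for `d ≥ 1`, `L ≥ 3`, `β > 0`,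
  `λ ≥ 0` the nearest-neighbour `1–1` correlation of the Gibbs state of `hardCoreLatticeGas d L λ`
  ([LSSY2005] (11.2)) obeys `e₁ ≥ 1/8 - λ/(4d) - log 2/(2dβ)`.

The printed source of the bound is the zero-temperature remark of Kennedy–Lieb–Shastry
[KLS1988PRL, p. 2583, after eq. (8)]: "A simple variational argument (using the wave function
with all spins aligned in the 1 direction) shows `e₁ ≥ ½S²` in all dimensions" (here `S = ½`),
whose `λ = 0`, `T = 0` Lean form is the tree's `kls_xy_bondCorr_lower_holds`
(`XYOrderDischarges.lean`).  At positive temperature and `λ ≥ 0` the same trial state is combined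
with the energy–entropy bound `⟨H⟩_β ≤ E₀(H) + log(dim)/β` (Gibbs variational principle; the
tree's `Matrix.re_gibbsState_hamiltonian_le`, `DuhamelTwoPoint.lean`):

1. `Re ⟨H⟩_β ≤ Re ⟨ψ, Hψ⟩ + |Λ| log 2/β` for every unit vector `ψ` (`dim = 2^{|Λ|}`);
2. for `ψ = ⊗_x V|↑⟩` (all spins along the 1-axis, `V S³V† = S¹`, `V S¹V† = -S³`, `V S²V† = S²`):
   `⟨ψ, H_XY ψ⟩ = -¼|E|` (`xyTorus_trialEnergy`) and `⟨ψ, S³_x ψ⟩ = ⟨↑|(-S¹)|↑⟩ = 0`, so the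
   staggered field `F = Σ_x (½ + (-1)^x S³_x)` contributes `λ|Λ|/2`;
3. `F ≥ 0` (`½ ± S³_x ≥ 0`), hence `Re ⟨H_XY⟩_β ≤ Re ⟨H⟩_β` for `λ ≥ 0`;
4. `Re ⟨H_XY⟩_β = -2 Σ_{e ∈ E} G¹(e)` by the `1 ↔ 2` symmetry (Sᵀ) (`hc_corr_one_eq_zero_holds`)
   and the symmetry of `G¹` (`hcCorr_symm`);
5. for `L ≥ 3` every edge of the torus comes from exactly one pair `(x, i)`, `|E| = d L^d`
   (`sum_pairs_eq_sum_edgeFinset`), so `Σ_{x,i} G¹(x, x+eᵢ) = Σ_E G¹ = d L^d e₁`;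

whence `-2dL^d e₁ ≤ -dL^d/4 + λL^d/2 + L^d log 2/β`, i.e. (Dᵀ).

## References

* [KLS1988PRL] T. Kennedy, E. H. Lieb, B. S. Shastry, *The XY model has long-range order for all
  spins and all dimensions greater than one*, Phys. Rev. Lett. 61 (1988) 2582–2584, p. 2583
  (after eq. (8)); reprinted in E. H. Lieb, *Statistical Mechanics (Selecta)*, Springer 2004.
* [LSSY2005] E. H. Lieb, R. Seiringer, J. P. Solovej, J. Yngvason, *The Mathematics of the Bose
  Gas and its Condensation*, Oberwolfach Seminars 34, Birkhäuser 2005 (arXiv:cond-mat/0610117),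
  Ch. 11, eq. (11.2).
-/

noncomputable section

open Filter Topology Matrix Finset
open Literature.MathematicalPhysics.QuantumLattice Literature.Probability.LatticeModels
open scoped ComplexOrder

namespace Literature.Barriers.AtomisticToContinuum.BoseGas

variable {d : ℕ}

/-! ### Auxiliary: energy–entropy bound against a trial vector -/

/-- **Energy–entropy bound, variational form**: `Re ⟨H⟩_β ≤ Re ⟨ψ, Hψ⟩ + log(dim)/β` for every
unit vector `ψ` and `β > 0` (the tree's `Matrix.re_gibbsState_hamiltonian_le` at an index where
the least eigenvalue is attained, and the variational principle `E₀ ≤ ⟨ψ, Hψ⟩`,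
`Matrix.groundEnergy_le_rayleigh_holds`). [folklore] -/
theorem hc_re_gibbsState_self_le_rayleigh {m : Type*} [Fintype m] [DecidableEq m] [Nonempty m]
    {H : Matrix m m ℂ} (hH : H.IsHermitian) {β : ℝ} (hβ : 0 < β) (ψ : m → ℂ)
    (hψ : star ψ ⬝ᵥ ψ = 1) :
    (gibbsState β H H).re ≤ (star ψ ⬝ᵥ H *ᵥ ψ).re + Real.log (Fintype.card m) / β := by
  obtain ⟨i₀, hi₀⟩ := exists_eq_ciInf_of_finite (f := hH.eigenvalues)
  have h1 := re_gibbsState_hamiltonian_le hH hβ i₀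
  have h2 : hH.eigenvalues i₀ ≤ (star ψ ⬝ᵥ H *ᵥ ψ).re := by
    rw [hi₀, ← groundEnergy_eq_iInf_eigenvalues_holds hH]
    exact groundEnergy_le_rayleigh_holds hH ψ hψ
  linarith

/-- `⟨0| Sˣ |0⟩ = 0` (the raising and lowering operators have no diagonal entries).
Tasaki (2020) §2.1, eq. (2.1.6). [folklore] -/
theorem spinX_apply_zero_zero (n : ℕ) : spinX n 0 0 = 0 := by
  rw [spinX, Matrix.smul_apply, Matrix.add_apply, spinLower_eq_conjTranspose, conjTranspose_apply,
    spinRaise_apply, if_neg (by simp), star_zero, add_zero, smul_zero]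

/-! ### Thermal expectations of the pieces of `hardCoreLatticeGas` -/

/-- Real part of the Gibbs state on a symmetrised bond:
`Re ⟨½(Sᵅ_xSᵅ_y + Sᵅ_ySᵅ_x)⟩_β = G^α(x,y)` (symmetry of `G^α`, `hcCorr_symm`). [folklore] -/
theorem hc_re_gibbsState_spinBond (β : ℝ) (L : ℕ) [NeZero L] (lam : ℝ) (α : Fin 3)
    (x y : TorusSite d L) :
    (gibbsState β (hardCoreLatticeGas d L lam) (spinBond 1 α x y)).re = hcCorr α β L lam x y := by
  have h1 : (gibbsState β (hardCoreLatticeGas d L lam) (siteSpin 1 x α * siteSpin 1 y α)).re =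
      hcCorr α β L lam x y := by
    rw [hcCorr_of_neZero, thermalCorr]
  have h2 : (gibbsState β (hardCoreLatticeGas d L lam) (siteSpin 1 y α * siteSpin 1 x α)).re =
      hcCorr α β L lam x y := by
    rw [hcCorr_symm, hcCorr_of_neZero, thermalCorr]
  rw [spinBond, LinearMap.map_smul, map_add, smul_eq_mul,
    show (1 / 2 : ℂ) = ((1 / 2 : ℝ) : ℂ) by push_cast; ring, Complex.re_ofReal_mul,
    Complex.add_re, h1, h2]
  ring

/-- **The thermal energy of the hopping term, edge by edge**: `Re ⟨H_XY⟩_β = -2 Σ_{e ∈ E} G¹(e)`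
in the Gibbs state of the hard-core lattice gas (by (Sᵀ) `G² = G¹`, `hc_corr_one_eq_zero_holds`,
and the symmetry of `G¹`). [cite: KLS1988PRL, eq. (3) ("e₁ is minus half the ground-state energy per bond")] -/
theorem hc_re_gibbsState_xyTorus (β : ℝ) (L : ℕ) [NeZero L] (lam : ℝ) :
    (gibbsState β (hardCoreLatticeGas d L lam) (xyTorus d L 1)).re =
      -2 * ∑ e ∈ (torusGraph d L).edgeFinset, Sym2.lift
        ⟨fun x y => hcCorr 0 β L lam x y, fun x y => hcCorr_symm 0 β L lam x y⟩ e := by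
  have hS : ∀ x y : TorusSite d L, hcCorr 1 β L lam x y = hcCorr 0 β L lam x y :=
    fun x y => hc_corr_one_eq_zero_holds d L β lam x y
  have key : ∀ x y : TorusSite d L, (gibbsState β (hardCoreLatticeGas d L lam)
      (spinBond 1 0 x y + spinBond 1 1 x y + ((0 : ℝ) : ℂ) • spinBond 1 2 x y)).re =
      2 * hcCorr 0 β L lam x y := by
    intro x y
    rw [map_add, map_add, Complex.add_re, Complex.add_re, hc_re_gibbsState_spinBond,
      hc_re_gibbsState_spinBond, LinearMap.map_smul, Complex.ofReal_zero, zero_smul,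
      Complex.zero_re, add_zero, hS]
    ring
  rw [show xyTorus d L 1 = ((-1 : ℝ) : ℂ) • ∑ e ∈ (torusGraph d L).edgeFinset,
      Sym2.lift ⟨fun x y => spinBond 1 0 x y + spinBond 1 1 x y + ((0 : ℝ) : ℂ) • spinBond 1 2 x y,
        fun x y => by simp only [spinBond_comm]⟩ e from rfl]
  rw [LinearMap.map_smul, map_sum, smul_eq_mul, Complex.re_ofReal_mul, Complex.re_sum, neg_mul,
    one_mul, neg_mul, neg_inj, mul_sum]
  refine sum_congr rfl fun e _ => ?_
  induction e using Sym2.ind with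
  | h x y => rw [Sym2.lift_mk, Sym2.lift_mk, key]

/-- **The staggered field is nonnegative in expectation**: each term `½ + (-1)^x S³_x` is
positive semidefinite for spin `½` (`½ ± S³_x ≥ 0`), and Gibbs states of Hermitian Hamiltonians are
positive. [cite: LSSY2005, Ch. 11 (11.2) ("adding a convenient constant to make the periodic potential positive")] -/
theorem hc_re_gibbsState_staggeredField_nonneg (β : ℝ) (L : ℕ) [NeZero L] (lam : ℝ) :
    0 ≤ (gibbsState β (hardCoreLatticeGas d L lam) (∑ x : TorusSite d L,
      ((1 / 2 : ℂ) • (1 : Op (TorusSite d L) 2) +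
        ((-1 : ℂ) ^ (∑ i, (x i).val)) • siteSpin 1 x 2))).re := by
  rw [map_sum, Complex.re_sum]
  refine sum_nonneg fun x _ => ?_
  have hpsd : Matrix.PosSemidef ((1 / 2 : ℂ) • (1 : Op (TorusSite d L) 2) +
      ((-1 : ℂ) ^ (∑ i, (x i).val)) • siteSpin 1 x 2) := by
    rcases Nat.even_or_odd (∑ i, (x i).val) with hk | hk
    · have h := posSemidef_smul_one_add_siteSpin (Λ := TorusSite d L) 1 x 2
      rw [Nat.cast_one] at h
      rwa [hk.neg_one_pow, one_smul]
    · have h := posSemidef_smul_one_sub_siteSpin (Λ := TorusSite d L) 1 x 2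
      rw [Nat.cast_one] at h
      rwa [hk.neg_one_pow, neg_one_smul, ← sub_eq_add_neg]
  obtain ⟨hre, -⟩ := Complex.nonneg_iff.mp
    (gibbsState_nonneg_of_posSemidef β (hardCoreLatticeGas_isHermitian d L lam) hpsd)
  exact hre

/-! ### The trial state: all spins along the `1`-axis -/

/-- **Trial expectation of the staggered field**: in the rotated basis state `(⨂V)|0…0⟩` with
`V S¹ V† = -S³` (all spins along the `1`-axis) one has `⟨S³_x⟩ = ⟨0|(-S¹)|0⟩ = 0`, so
`⟨Σ_x (½ + (-1)^x S³_x)⟩ = |Λ|/2`. [cite: KLS1988PRL, p. 2583 (after eq. (8))] -/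
theorem hc_staggeredField_trialEnergy (L : ℕ) [NeZero L] {V : Matrix (Fin 2) (Fin 2) ℂ}
    (hV' : Vᴴ * V = 1) (hVx : V * spinX 1 * Vᴴ = -SpinOperators.spinZ 1) :
    (productOp (fun _ : TorusSite d L => Vᴴ) *
        (∑ x : TorusSite d L, ((1 / 2 : ℂ) • (1 : Op (TorusSite d L) 2) +
          ((-1 : ℂ) ^ (∑ i, (x i).val)) • siteSpin 1 x 2)) *
        (productOp (fun _ : TorusSite d L => Vᴴ))ᴴ) (fun _ => 0) (fun _ => 0) =
      (Fintype.card (TorusSite d L) : ℂ) / 2 := by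
  set u : TorusSite d L → Matrix (Fin 2) (Fin 2) ℂ := fun _ => Vᴴ with hu_def
  have hu : ∀ z, u z * (u z)ᴴ = 1 := fun _ => by rw [hu_def, conjTranspose_conjTranspose, hV']
  have hWW : productOp u * (productOp u)ᴴ = 1 := productOp_mul_conjTranspose hu
  -- `V† S³ V = -S¹`
  have hz : Vᴴ * SpinOperators.spinZ 1 * V = -spinX 1 := by
    have h1 : Vᴴ * (V * spinX 1 * Vᴴ) * V = spinX 1 := by
      rw [← Matrix.mul_assoc, ← Matrix.mul_assoc, hV', Matrix.one_mul, Matrix.mul_assoc, hV',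
        Matrix.mul_one]
    rw [hVx, Matrix.mul_neg, Matrix.neg_mul] at h1
    rw [← h1, neg_neg]
  have hS3 : ∀ x : TorusSite d L,
      productOp u * siteSpin 1 x 2 * (productOp u)ᴴ = onSite x (-spinX 1) := by
    intro x
    rw [productOp_conj_siteSpin hu, spinVec_two, hu_def]
    simp only [conjTranspose_conjTranspose, hz]
  have hterm : ∀ x ∈ (univ : Finset (TorusSite d L)),
      (productOp u * ((1 / 2 : ℂ) • (1 : Op (TorusSite d L) 2) +
          ((-1 : ℂ) ^ (∑ i, (x i).val)) • siteSpin 1 x 2) * (productOp u)ᴴ)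
        (fun _ => 0) (fun _ => 0) = 1 / 2 := by
    intro x _
    rw [Matrix.mul_add, Matrix.add_mul, Matrix.mul_smul, Matrix.smul_mul, Matrix.mul_smul,
      Matrix.smul_mul, Matrix.mul_one, hWW, hS3]
    simp [onSite_apply, spinX_apply_zero_zero]
  rw [Finset.mul_sum, Finset.sum_mul, Matrix.sum_apply, sum_congr rfl hterm, sum_const, card_univ,
    nsmul_eq_mul, mul_one_div]

/-! ### (Dᵀ) The energy bound -/

/-- **Discharge of (Dᵀ)** `hc_bondCorr_lower_thermal`: `e₁ ≥ 1/8 - λ/(4d) - log 2/(2dβ)` for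
`d ≥ 1`, `L ≥ 3`, `β > 0`, `λ ≥ 0`.  Energy–entropy bound `Re⟨H⟩_β ≤ ⟨ψ,Hψ⟩ + |Λ| log 2/β` with
the product trial state of Kennedy–Lieb–Shastry (all spins along the `1`-axis:
`⟨ψ,Hψ⟩ = -d|Λ|/4 + λ|Λ|/2`), positivity of the staggered field, `Re⟨H_XY⟩_β = -2d|Λ| e₁`.
[cite: KLS1988PRL, p. 2583 (after eq. (8))] [cite: LSSY2005, Ch. 11 (11.2)] -/
theorem hc_bondCorr_lower_thermal_holds : hc_bondCorr_lower_thermal := by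
  intro d hd L hL β lam hβ hlam
  haveI : NeZero L := ⟨by omega⟩
  have hL2 : 2 ≤ L := by omega
  have hLne2 : L ≠ 2 := by omega
  have hd0 : (d : ℝ) ≠ 0 := by exact_mod_cast (show d ≠ 0 by omega)
  have hdpos : (0 : ℝ) < d := by exact_mod_cast (show 0 < d by omega)
  have hLpos : (0 : ℝ) < L := by exact_mod_cast (show 0 < L by omega)
  have hNpos : (0 : ℝ) < (L : ℝ) ^ d := by positivity
  have hβ0 : β ≠ 0 := hβ.ne'
  have hHerm : (hardCoreLatticeGas d L lam).IsHermitian := hardCoreLatticeGas_isHermitian d L lam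
  -- cardinalities: `|Λ| = L^d`, `log dim = |Λ| log 2`, `|E| = d L^d`
  have hcardΛ : (Fintype.card (TorusSite d L) : ℝ) = (L : ℝ) ^ d := by
    rw [Fintype.card_pi, prod_const, ZMod.card, card_univ, Fintype.card_fin]
    push_cast
    ring
  have hlog : Real.log (Fintype.card (TensorIndex (TorusSite d L) 2)) = (L : ℝ) ^ d * Real.log 2 := by
    rw [Fintype.card_pi, prod_const, card_univ, Fintype.card_fin, Nat.cast_pow, Real.log_pow,
      hcardΛ, Nat.cast_ofNat]
  set g : Sym2 (TorusSite d L) → ℝ :=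
    Sym2.lift ⟨fun x y => hcCorr 0 β L lam x y, fun x y => hcCorr_symm 0 β L lam x y⟩ with hg
  have h4 := sum_pairs_eq_sum_edgeFinset L hL2 g
  have h5 := sum_pairs_eq_sum_edgeFinset (d := d) L hL2 (fun _ => (1 : ℝ))
  rw [if_neg hLne2, one_mul] at h4 h5
  simp only [sum_const, card_univ, nsmul_eq_mul, mul_one, Fintype.card_fin] at h5
  have hEcard : ((torusGraph d L).edgeFinset.card : ℝ) = (d : ℝ) * (L : ℝ) ^ d := by
    rw [← h5, hcardΛ, mul_comm]
  -- (4) the hopping energy edge by edge, (3) positivity of the staggered field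
  have hxy := hc_re_gibbsState_xyTorus (d := d) β L lam
  have hF := hc_re_gibbsState_staggeredField_nonneg (d := d) β L lam
  have hlamF := mul_nonneg hlam hF
  -- (2) the trial state `ψ = (⨂V)|0…0⟩`
  obtain ⟨V, hV, hV', hVz, hVx, hVy⟩ := exists_unitary_conj_spinZ_eq_spinX 1
  set W : Op (TorusSite d L) 2 := productOp (fun _ : TorusSite d L => Vᴴ) with hW
  have hWW : W * Wᴴ = 1 :=
    productOp_mul_conjTranspose fun _ => by rw [conjTranspose_conjTranspose, hV']
  set v : TensorIndex (TorusSite d L) 2 → ℂ := Pi.single (fun _ => 0) 1 with hv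
  have hstar : star v = v := by rw [hv, ← Pi.single_star, star_one]
  have hψ : star (Wᴴ *ᵥ v) ⬝ᵥ (Wᴴ *ᵥ v) = 1 := by
    rw [star_mulVec, conjTranspose_conjTranspose, ← dotProduct_mulVec, mulVec_mulVec, hWW,
      one_mulVec, hstar, hv, single_dotProduct, Pi.single_eq_same, one_mul]
  have hray : (star (Wᴴ *ᵥ v) ⬝ᵥ hardCoreLatticeGas d L lam *ᵥ (Wᴴ *ᵥ v)).re =
      -((d : ℝ) * (L : ℝ) ^ d) / 4 + lam * (L : ℝ) ^ d / 2 := by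
    rw [star_mulVec, conjTranspose_conjTranspose, ← dotProduct_mulVec, mulVec_mulVec,
      mulVec_mulVec, hstar, hv, single_dotProduct, one_mul, mulVec_single_one, Matrix.col_apply,
      hardCoreLatticeGas_eq, Matrix.mul_add, Matrix.add_mul, Matrix.mul_smul, Matrix.smul_mul,
      Matrix.add_apply, Matrix.smul_apply, smul_eq_mul, hW, xyTorus_trialEnergy L 1 hV hV' hVz hVy,
      hc_staggeredField_trialEnergy L hV' hVx]
    have hc : (-((((1 : ℕ) : ℂ) / 2) ^ 2 * ((torusGraph d L).edgeFinset.card : ℂ)) +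
        (lam : ℂ) * ((Fintype.card (TorusSite d L) : ℂ) / 2)) =
        ((-((1 / 2) ^ 2 * ((torusGraph d L).edgeFinset.card : ℝ)) +
          lam * ((Fintype.card (TorusSite d L) : ℝ) / 2) : ℝ) : ℂ) := by
      push_cast
      ring
    rw [hc, Complex.ofReal_re, hEcard, hcardΛ]
    ring
  -- (1) energy–entropy bound against the trial state
  have hee := hc_re_gibbsState_self_le_rayleigh hHerm hβ (Wᴴ *ᵥ v) hψ
  rw [hray, hlog] at hee
  -- `⟨H⟩ = ⟨H_XY⟩ + λ ⟨F⟩`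
  have hsplit : (gibbsState β (hardCoreLatticeGas d L lam) (hardCoreLatticeGas d L lam)).re =
      (gibbsState β (hardCoreLatticeGas d L lam) (xyTorus d L 1)).re +
        lam * (gibbsState β (hardCoreLatticeGas d L lam) (∑ x : TorusSite d L,
          ((1 / 2 : ℂ) • (1 : Op (TorusSite d L) 2) +
            ((-1 : ℂ) ^ (∑ i, (x i).val)) • siteSpin 1 x 2))).re := by
    have h : gibbsState β (hardCoreLatticeGas d L lam) (hardCoreLatticeGas d L lam) =
        gibbsState β (hardCoreLatticeGas d L lam) (xyTorus d L 1 + (lam : ℂ) •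
          ∑ x : TorusSite d L, ((1 / 2 : ℂ) • (1 : Op (TorusSite d L) 2) +
            ((-1 : ℂ) ^ (∑ i, (x i).val)) • siteSpin 1 x 2)) := rfl
    rw [h, map_add, LinearMap.map_smul, smul_eq_mul, Complex.add_re, Complex.re_ofReal_mul]
  rw [hsplit, hxy] at hee
  -- the main inequality: `-2 Σ_E G¹ + λ⟨F⟩ ≤ -d L^d/4 + λ L^d/2 + L^d log 2/β`
  -- (5) pairs versus edges, and the arithmetic
  rw [hcBondCorr_of_neZero, le_div_iff₀ (by positivity)]
  have hg' : ∀ (x : TorusSite d L) (i : Fin d),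
      hcCorr 0 β L lam x (x + Pi.single i 1) = g s(x, x + Pi.single i 1) := fun x i => rfl
  simp_rw [hg']
  rw [h4]
  rw [show (1 / 8 - lam / (4 * d) - Real.log 2 / (2 * d * β)) * ((d : ℝ) * (L : ℝ) ^ d) =
      ((d : ℝ) * (L : ℝ) ^ d) / 8 - (lam * (L : ℝ) ^ d / 2) / 2 -
        ((L : ℝ) ^ d * Real.log 2 / β) / 2 by
    field_simp
    ring]
  linarith

end Literature.Barriers.AtomisticToContinuum.BoseGas
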